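import Literature.MathematicalPhysics.QuantumFieldTheory.Balaban1983to89.B4Cor23ZeroTorusEta

/-!
# `Balaban1983to89.B1Prop22ZeroFieldTorus` — T. Bałaban, *(Higgs)₂,₃ quantum fields in a finite volume. I. A lower bound*, Commun. Math.
# Phys. **85** (1982) 603–626 [Balaban1982Higgs1]: **Proposition 2.2** (2.27) p. 611 — the exponential decay of the kernel of
# `Δ^{(k)}(Ω,A) = a_kI − a_k²Q_k(A)G_k(Ω,A)Q_k^*(A)` — PROVED at `A = 0` ON THE WHOLE TORUS `Ω = T_ε` of Bałaban's concrete scalar tower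
# (`B1RG242Torus.tower`, top level `k = K`, every volume, every mass `m² ≥ 0`), from [B4] Corollary 2.3 on the torus

statement-level skeleton of published theorems with citation tags; proofs where landed; nothing here is a claim about the Yang–Mills mass gap

PDF held: `paper:balaban1982-cmp85-higgs23-i` (journal page = PDF page + 602), p. 611 [PDF 9] (Prop. 2.2), p. 610 [PDF 8] ((2.20)–(2.22));
[B4] = `paper:balaban1983-cmp89-regularity-decay`, pp. 580–581 [PDF 10–11] (Cor. 2.3), pp. 593–594 [PDF 23–24] ((5.4): *"Finally Corollary 2.3
implies that the considered operator is short-ranged"*); read by this seat.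

CITATION HEADER (lean-in-tree rule).  Cell `lit-balaban` (HOME `run/shared/lean/pub/lit-balaban/`), Phase-2 proof seat **p14** gen 10 (unit
`lit-balaban-p14`); SKELETON row **B1.Prop2.2** (decls of record `B1.Prop22Literal` / `B1.Prop22Small`, owners r01/r14): the ZERO-FIELD TORUS
instance — sibling of p17's `B1Prop22Proof` (zero field on nested finite REGIONS of `ℤ^{d+1}`, and the abstract derivation
`prop22Small_of_cor23Printed`) and of `B1Prop22RegularField` (`A ≠ 0`).  USED BY NAME, never restated: `B1RG242.StepData.Δk` (the matrix
`α·1 − α²·Q_kG_kQ_k^*` of (2.21), = [B4] (1.14)) of the torus tower `B1RG242Torus.tower P a m²` at its top level, `B1RG242Torus.{Qk, Qks, QkQks,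
α}`, `B4Ineq115Torus.wj`, this seat's `B4Cor23ZeroTorus.cor23_zero_torus` ([B4] (2.30) on the torus, first pairing) and
`B4Cor23ZeroTorusEta.G_top_eq_Grs`, `B4Cor23ZeroTorusSolve.Qk_apply`, `B5Ineq137Torus.{T, distX, blk, fine, T_blk_le, T_fine_fine}`,
`B5CombesThomasTorus.nsq`, `Params.spacing_K` (`L^Kε = 1`).

WHAT IS PRINTED (verbatim, I p. 611 [PDF 9]).  *"We will formulate some consequences of the above theorem. The first concerns the operator
Δ^{(k),L^kε}(Ω, A) rescaled to the unit lattice, i.e. the operator Δ^{(k)}(Ω, A).  Proposition 2.2. If a configuration A is regular in the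
same sense as in Proposition 2.1 then there exist constants δ₀ > 0 and c₀, depending on the same quantities as in Proposition 2.1, such that
|Δ^{(k)}(Ω,A;x,x′)| ≤ c₀exp(−δ₀|x−x′|), x,x′ ∈ Ω^{(k)}. (2.27) Putting for Ω ⊂ Ω₀  δΔ^{(k)}(Ω,Ω₀,A) = Δ^{(k)}(Ω,A) − Δ^{(k)}(Ω₀,A), (2.28) the
following inequality holds |δΔ^{(k)}(Ω,Ω₀,A;x,x′)| ≤ c₀ exp(−δ₀(|x−x′| + dist(x,Ω^{(k)c}) + dist(x′,Ω^{(k)c}))). (2.29)"*; p. 610 [PDF 8]: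
*"⟨ψ, Δ^{(k),L^kε}(Ω,A)ψ⟩ = a_k(L^kε)^{−2}⟨ψ,ψ⟩ − a_k²(L^kε)^{−4}⟨ψ, Q_k(A)G^ε_k(Ω,A)Q_k^*(A)ψ⟩ (2.21)"*; [B4] p. 593–594 [PDF 23–24]:
*"Finally Corollary 2.3 implies that the considered operator is short-ranged in the sense that for some δ₀ > 0
|(Δ^{(k)}(Ω,A) + aL^{−2}P(A))(x,x′)| ≤ c₀e^{−δ₀|x−x′|}, x, x′ ∈ Ω^{(k)} (5.4)"*.

WHAT THIS FILE PROVES (kernel-checked, zero `sorry`, theorems only; axioms standard).  `A = 0`, `Ω = Ω₀ = T_ε`, the tower's top level `k = K`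
(unit lattice `T^{(K)} = Site P K`, `L^Kε = 1`, so `Δ^{(K),L^Kε} = Δ^{(K)}`):
* §1 `T_blk_sub_two_le_distX`: two fine points are at least `|y − y′|_{T^{(k)}} − 2` apart in `η`-units, `y, y′` their `k`-blocks
  (block corners `T_blk_le`, `T_fine_fine`).
* §2 the rows of `Q_k` and the columns of `Q_k^*`: `Qks_apply`, `Qk_eq_wj_mul_Qks` (`Q_k(y,·) = w_k·Q_k^*(·,y)`), `sum_Qks_col` (`Σ_xQ_k^*(x,y) =
  w_k⁻¹`, from `Q_kQ_k^* = 1`), `nsq_Qks_col = w_k⁻¹`, `nsq_Qk_row = w_k`, `sqrt_nsq_row_mul_col = 1`; `QGQ_apply` (`(Q_kGQ_k^*)(y,y′) =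
  ⟨Q_k(y,·), G Q_k^*(·,y′)⟩`).
* §3 `Δk_top_eq`: the tower's `Δ^{(K)}` IS `a_K·1 − a_K²·Q_KG_K^{resc}Q_K^*` (`α_K = a_K`, `G_K = G_K^{resc}` at `L^Kε = 1`); **`abs_Δk_top_le`**: any `L²`
  pairing bound `|⟨f, G_K^{resc}f′⟩| ≤ ce^{−δr}‖f‖‖f′‖` (supports `≥ r` apart) gives `|Δ^{(K)}(T_ε,0; y,y′)| ≤ (a_K + a_K²ce^{2δ})e^{−δ|y−y′|}` —
  the mechanism *"Corollary 2.3 implies that the considered operator is short-ranged"* ([B4] p. 593).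
* §4 **`prop22_kernel_zeroField_torus`** — (2.27) AT `A = 0` ON THE TORUS: for `L > 1`, `a > 0`, every `d` there are `δ₀, c₀ > 0` such that for
  EVERY volume `P = (d, L, m, K)` with `K ≥ 1` and every `m² ≥ 0`: `|Δ^{(K)}(T_ε, 0; y, y′)| ≤ c₀e^{−δ₀|y−y′|_{T^{(K)}}}` (`c₀ = a + a²c₀′e^{2δ₀}`
  with `(δ₀, c₀′)` of `cor23_zero_torus`); `deltaΔk_torus_eq_zero` ((2.28) on the whole torus: `δΔ^{(k)}(T_ε,T_ε,0) = 0`, so (2.29) is moot).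
HONEST SCOPE.  `A = 0`, `U ≡ 1`, one component (at `A = 0` the `N` components decouple and `Δ^{(k)}` is diagonal in them), the WHOLE torus only
(no `Ω ⊊ T_ε`: (2.29) carries no information here), the top level `k = K` of each volume (lower levels are top levels of other volumes, as in
p38's `torusEtaFam`), the sup torus distance `T P K` of `T^{(K)}`; constants existential (functions of `d, L, a`); the typed `B1.Prop22Literal`
packaging of this bound for a `B1.DeltaSetting` family is left to a definition-lane sequel; nothing here is summit progress.
-/

namespace Literature.MathematicalPhysics.QuantumFieldTheory.Balaban1983to89

open Matrix Finset

noncomputable section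

namespace B1Prop22ZeroFieldTorus

open B1RG242Torus B5Ineq137Torus B5CombesThomasTorus B4Ineq115Torus B5Display136Torus B4Cor23ZeroTorus
  B4Cor23ZeroTorusSolve B4Cor23ZeroTorusEta B4ThmZeroTorusEta

variable {P : Params} {k : ℕ}

/-! ## §1 Block geometry: two blocks are at least `|y − y′| − 2` apart in `η`-units -/

/-- Two fine points `x, x′` are at least `|y − y′|_{T^{(k)}} − 2` apart in `η = L^{−k}`-units, `y, y′` their `k`-blocks (each point is
within `L^k − 1` fine steps of its block corner, and corners are exactly `L^k|y − y′|` apart). [cite: Balaban1983RegularityDecay, (1.4) p.572;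
Balaban1982Higgs1, (1.3) p.604] -/
theorem T_blk_sub_two_le_distX (hk : k ≤ P.m + P.K) (x x' : Site P 0) :
    T P k (blk P k x) (blk P k x') - 2 ≤ distX P k x x' := by
  have hL : (0 : ℝ) < (P.L : ℝ) ^ k := pow_pos P.cast_L_pos k
  have h1 : T P 0 x (fine P k (blk P k x)) ≤ (P.L : ℝ) ^ k - 1 := T_blk_le P hk x
  have h2 : T P 0 x' (fine P k (blk P k x')) ≤ (P.L : ℝ) ^ k - 1 := T_blk_le P hk x'
  have h3 : T P 0 (fine P k (blk P k x)) (fine P k (blk P k x')) = (P.L : ℝ) ^ k * T P k (blk P k x) (blk P k x') :=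
    T_fine_fine P hk _ _
  have t1 := T_triangle P 0 (fine P k (blk P k x)) x (fine P k (blk P k x'))
  have t2 := T_triangle P 0 x x' (fine P k (blk P k x'))
  rw [T_symm P 0 x] at h1
  unfold distX
  rw [inv_mul_eq_div, le_div_iff₀ hL,
    show (T P k (blk P k x) (blk P k x') - 2) * (P.L : ℝ) ^ k
      = (P.L : ℝ) ^ k * T P k (blk P k x) (blk P k x') - 2 * (P.L : ℝ) ^ k by ring, ← h3]
  linarith

/-! ## §2 The rows of `Q_k` and the columns of `Q_k^*` -/

/-- The entries of `Q_k^*`: `Q_k^*(x, y) = [x ∈ B^k(y)]`. [cite: Balaban1982Higgs1, (1.5) p.604, (2.11) p.609] -/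
theorem Qks_apply (k : ℕ) (x : Site P 0) (y : Site P k) :
    Qks P k x y = if Site.proj k (lvl P k) x = y then 1 else 0 := rfl

/-- `Q_k(y, x) = w_k·Q_k^*(x, y)` (`Q_k^* = w_k⁻¹Q_kᵀ`). [cite: Balaban1982Higgs1, (1.5) p.604, (2.11) p.609] -/
theorem Qk_eq_wj_mul_Qks (k : ℕ) (y : Site P k) (x : Site P 0) : Qk P k y x = wj P k * Qks P k x y := by
  rw [Qk_apply, Qks_apply]
  split_ifs <;> simp

/-- the entries of `Q_k^*` are idempotent (`0` or `1`). [folklore] -/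
private theorem Qks_mul_self (k : ℕ) (x : Site P 0) (y : Site P k) : Qks P k x y * Qks P k x y = Qks P k x y := by
  rw [Qks_apply]
  split_ifs <;> simp

/-- `Σ_x Q_k^*(x, y) = w_k⁻¹` — the block `B^k(y)` has `w_k⁻¹ = L^{d·lvl k}` points (read off `Q_kQ_k^* = 1`). [cite: Balaban1982Higgs1, (2.11)
p.609; Balaban1983RegularityDecay, (1.5) p.572] -/
theorem sum_Qks_col (k : ℕ) (y : Site P k) : ∑ x, Qks P k x y = (wj P k)⁻¹ := by
  have h1 : (Qk P k * Qks P k) y y = 1 := by rw [QkQks P k, Matrix.one_apply_eq]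
  rw [Matrix.mul_apply] at h1
  simp_rw [Qk_eq_wj_mul_Qks, mul_assoc, Qks_mul_self, ← Finset.mul_sum] at h1
  exact (inv_eq_of_mul_eq_one_right h1).symm

/-- `Σ_x Q_k^*(x, y)² = w_k⁻¹`. [cite: Balaban1982Higgs1, (2.11) p.609] -/
theorem nsq_Qks_col (k : ℕ) (y : Site P k) : nsq P (fun x => Qks P k x y) = (wj P k)⁻¹ := by
  unfold nsq
  simp_rw [sq, Qks_mul_self]
  exact sum_Qks_col k y

/-- `Σ_x Q_k(y, x)² = w_k`. [cite: Balaban1982Higgs1, (2.11) p.609] -/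
theorem nsq_Qk_row (k : ℕ) (y : Site P k) : nsq P (fun x => Qk P k y x) = wj P k := by
  have hw : wj P k ≠ 0 := (wj_pos P k).ne'
  unfold nsq
  simp_rw [Qk_eq_wj_mul_Qks, mul_pow, ← Finset.mul_sum, sq, Qks_mul_self, sum_Qks_col]
  field_simp

/-- `‖Q_k(y, ·)‖₂·‖Q_k^*(·, y′)‖₂ = 1`. [cite: Balaban1982Higgs1, (2.11) p.609] -/
theorem sqrt_nsq_row_mul_col (k : ℕ) (y y' : Site P k) :
    Real.sqrt (nsq P (fun x => Qk P k y x)) * Real.sqrt (nsq P (fun x => Qks P k x y')) = 1 := by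
  rw [nsq_Qk_row, nsq_Qks_col, ← Real.sqrt_mul (wj_pos P k).le, mul_inv_cancel₀ (wj_pos P k).ne', Real.sqrt_one]

/-- The kernel of `Q_kGQ_k^*` as a pairing: `(Q_kGQ_k^*)(y, y′) = ⟨Q_k(y, ·), G Q_k^*(·, y′)⟩`. [cite: Balaban1982Higgs1, (2.21) p.610] -/
theorem QGQ_apply (G : Matrix (Site P 0) (Site P 0) ℝ) (k : ℕ) (y y' : Site P k) :
    (Qk P k * G * Qks P k) y y' = (fun x => Qk P k y x) ⬝ᵥ (G *ᵥ fun x => Qks P k x y') := by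
  rw [Matrix.mul_assoc]
  rfl

/-- a point of the support of `Q_k(y, ·)` lies in the block of `y`. [folklore] -/
private theorem blk_eq_of_Qk_ne_zero (hk : k ≤ P.m + P.K) {y : Site P k} {x : Site P 0} (h : Qk P k y x ≠ 0) :
    blk P k x = y := by
  rw [Qk_apply, lvl_of_le P hk] at h
  by_contra hne
  exact h (if_neg hne)

/-- a point of the support of `Q_k^*(·, y)` lies in the block of `y`. [folklore] -/
private theorem blk_eq_of_Qks_ne_zero (hk : k ≤ P.m + P.K) {y : Site P k} {x : Site P 0} (h : Qks P k x y ≠ 0) :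
    blk P k x = y := by
  rw [Qks_apply, lvl_of_le P hk] at h
  by_contra hne
  exact h (if_neg hne)

/-! ## §3 `Δ^{(K)}(T_ε, 0)` at the top level and its kernel bound -/

/-- At the top level (`L^Kε = 1`) the tower's `Δ^{(K),L^Kε}(T_ε,0)` of (2.21) IS `a_K·1 − a_K²·Q_KG_K^{resc}Q_K^*` (`α_K = a_K(L^Kε)^{−2} = a_K`,
`G^ε_K = (L^Kε)²G_K^{resc} = G_K^{resc}`). [cite: Balaban1982Higgs1, (2.21)–(2.22) p.610] -/
theorem Δk_top_eq {a msq : ℝ} (ha : 0 < a) (hm : 0 ≤ msq) (hK : 1 ≤ P.K) :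
    ((tower P a msq).step P.K).Δk =
      B1.aSeq a P.L P.K • (1 : Matrix (Site P P.K) (Site P P.K) ℝ)
        - B1.aSeq a P.L P.K ^ 2 • (Qk P P.K * Grs P a msq P.K * Qks P P.K) := by
  have hα : ((tower P a msq).step P.K).α = B1.aSeq a P.L P.K := by
    show α P a P.K = _
    rw [α, P.spacing_K, one_pow, inv_one, mul_one]
  have hG : ((tower P a msq).step P.K).Gk = Grs P a msq P.K := G_top_eq_Grs ha hm hK
  unfold B1RG242.StepData.Δk
  rw [hα, hG]
  rfl

/-- **THE MECHANISM «Corollary 2.3 implies that the considered operator is short-ranged»** ([B4] p. 593, (5.4)) at `A = 0` on the torus: an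
`L²` pairing bound `|⟨f, G_K^{resc}f′⟩| ≤ ce^{−δr}‖f‖₂‖f′‖₂` for supports `≥ r` apart (`η`-units) gives
`|Δ^{(K)}(T_ε,0; y,y′)| ≤ (a_K + a_K²ce^{2δ})e^{−δ|y−y′|_{T^{(K)}}}` (the rows of `Q_K` and columns of `Q_K^*` live in the blocks `B^K(y)`,
`B^K(y′)`, which are `≥ |y−y′| − 2` apart, and `‖Q_K(y,·)‖₂‖Q_K^*(·,y′)‖₂ = 1`). [cite: Balaban1982Higgs1, Prop. 2.2 (2.27) p.611;
Balaban1983RegularityDecay, (5.4) p.593] -/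
theorem abs_Δk_top_le {a msq : ℝ} (ha : 0 < a) (hm : 0 ≤ msq) (hK : 1 ≤ P.K) {δ c : ℝ}
    (hG : ∀ (f f' : Site P 0 → ℝ) (r : ℝ), (∀ x x', f x ≠ 0 → f' x' ≠ 0 → r ≤ distX P P.K x x') →
      |f ⬝ᵥ (Grs P a msq P.K *ᵥ f')| ≤ c * Real.exp (-(δ * r)) * Real.sqrt (nsq P f) * Real.sqrt (nsq P f'))
    (y y' : Site P P.K) :
    |((tower P a msq).step P.K).Δk y y'|
      ≤ (B1.aSeq a P.L P.K + B1.aSeq a P.L P.K ^ 2 * c * Real.exp (2 * δ)) * Real.exp (-(δ * T P P.K y y')) := by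
  have hKle : P.K ≤ P.m + P.K := Nat.le_add_left _ _
  set aK := B1.aSeq a P.L P.K with haK
  have haK0 : 0 ≤ aK := (B1.aSeq_pos ha (one_lt_cast_L P) hK).le
  rw [Δk_top_eq ha hm hK, Matrix.sub_apply, Matrix.smul_apply, Matrix.smul_apply, Matrix.one_apply, QGQ_apply,
    smul_eq_mul, smul_eq_mul]
  -- the blocks of `y` and `y′` are `≥ |y − y′| − 2` apart
  have hsep : ∀ x x', Qk P P.K y x ≠ 0 → Qks P P.K x' y' ≠ 0 → T P P.K y y' - 2 ≤ distX P P.K x x' := by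
    intro x x' hx hx'
    have h := T_blk_sub_two_le_distX hKle x x'
    rwa [blk_eq_of_Qk_ne_zero hKle hx, blk_eq_of_Qks_ne_zero hKle hx'] at h
  have hpair := hG _ _ _ hsep
  rw [mul_assoc (c * Real.exp (-(δ * (T P P.K y y' - 2)))), sqrt_nsq_row_mul_col, mul_one,
    show -(δ * (T P P.K y y' - 2)) = 2 * δ + -(δ * T P P.K y y') by ring, Real.exp_add] at hpair
  -- the diagonal term
  have hdiag : |aK * (if y = y' then 1 else 0)| ≤ aK * Real.exp (-(δ * T P P.K y y')) := by
    split_ifs with h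
    · subst h
      rw [T_self, mul_zero, neg_zero, Real.exp_zero, abs_of_nonneg (by rw [mul_one]; exact haK0)]
    · rw [mul_zero, abs_zero]
      positivity
  calc |aK * (if y = y' then 1 else 0)
          - aK ^ 2 * ((fun x => Qk P P.K y x) ⬝ᵥ (Grs P a msq P.K *ᵥ fun x => Qks P P.K x y'))|
      ≤ |aK * (if y = y' then 1 else 0)|
          + |aK ^ 2 * ((fun x => Qk P P.K y x) ⬝ᵥ (Grs P a msq P.K *ᵥ fun x => Qks P P.K x y'))| := abs_sub _ _
    _ ≤ aK * Real.exp (-(δ * T P P.K y y')) + aK ^ 2 * (c * (Real.exp (2 * δ) * Real.exp (-(δ * T P P.K y y')))) := by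
          refine add_le_add hdiag ?_
          rw [abs_mul, abs_of_nonneg (sq_nonneg aK)]
          exact mul_le_mul_of_nonneg_left hpair (sq_nonneg aK)
    _ = (aK + aK ^ 2 * c * Real.exp (2 * δ)) * Real.exp (-(δ * T P P.K y y')) := by ring

/-! ## §4 Proposition 2.2 (2.27) at `A = 0` on the torus, uniformly in the volume -/

/-- **PROPOSITION 2.2 (2.27) AT `A = 0` ON THE WHOLE TORUS** (`Ω = T_ε`, top level `k = K`): for `L > 1`, `a > 0` and every `d` there are
`δ₀, c₀ > 0` (functions of `d, L, a`) such that for EVERY volume `P = (d, L, m, K)` with `K ≥ 1` and every `m² ≥ 0`,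
`|Δ^{(K)}(T_ε, 0; y, y′)| ≤ c₀e^{−δ₀|y−y′|_{T^{(K)}}}` for all `y, y′ ∈ T^{(K)}` — from [B4] Corollary 2.3 on the torus (`cor23_zero_torus`,
first pairing) by `abs_Δk_top_le`, with `a_K ≤ a` ((2.15)). [cite: Balaban1982Higgs1, Prop. 2.2 (2.27) p.611; Balaban1983RegularityDecay,
(5.4) p.593] -/
theorem prop22_kernel_zeroField_torus (d L : ℕ) (hL : 1 < L) {a : ℝ} (ha : 0 < a) :
    ∃ δ₀ c₀ : ℝ, 0 < δ₀ ∧ 0 < c₀ ∧ ∀ (P : Params), P.d = d → P.L = L → ∀ (msq : ℝ), 0 ≤ msq → 1 ≤ P.K →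
      ∀ y y' : Site P P.K, |((tower P a msq).step P.K).Δk y y'| ≤ c₀ * Real.exp (-(δ₀ * T P P.K y y')) := by
  obtain ⟨δ₀, c₀, hδ₀, hc₀, h⟩ := cor23_zero_torus d L hL ha
  refine ⟨δ₀, a + a ^ 2 * c₀ * Real.exp (2 * δ₀), hδ₀, by positivity, fun P hPd hPL msq hm hK y y' => ?_⟩
  have hG : ∀ (f f' : Site P 0 → ℝ) (r : ℝ), (∀ x x', f x ≠ 0 → f' x' ≠ 0 → r ≤ distX P P.K x x') →
      |f ⬝ᵥ (Grs P a msq P.K *ᵥ f')| ≤ c₀ * Real.exp (-(δ₀ * r)) * Real.sqrt (nsq P f) * Real.sqrt (nsq P f') :=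
    fun f f' r hsep => (h P hPd hPL msq hm P.K hK (Nat.le_add_left _ _) ⟨0, P.hd⟩ ⟨0, P.hd⟩ f f' r hsep).1
  refine (abs_Δk_top_le ha hm hK hG y y').trans (mul_le_mul_of_nonneg_right ?_ (Real.exp_pos _).le)
  have hL1 : (1 : ℝ) < P.L := one_lt_cast_L P
  have haK : B1.aSeq a P.L P.K ≤ a := B1.aSeq_le ha hL1 P.K hK
  have haK0 : 0 ≤ B1.aSeq a P.L P.K := (B1.aSeq_pos ha hL1 hK).le
  have hsq : B1.aSeq a P.L P.K ^ 2 ≤ a ^ 2 := pow_le_pow_left₀ haK0 haK 2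
  have hcE : 0 ≤ c₀ * Real.exp (2 * δ₀) := by positivity
  calc B1.aSeq a P.L P.K + B1.aSeq a P.L P.K ^ 2 * c₀ * Real.exp (2 * δ₀)
      = B1.aSeq a P.L P.K + B1.aSeq a P.L P.K ^ 2 * (c₀ * Real.exp (2 * δ₀)) := by ring
    _ ≤ a + a ^ 2 * (c₀ * Real.exp (2 * δ₀)) := add_le_add haK (mul_le_mul_of_nonneg_right hsq hcE)
    _ = a + a ^ 2 * c₀ * Real.exp (2 * δ₀) := by ring

/-- **(2.28) on the whole torus**: `δΔ^{(k)}(T_ε, T_ε, 0) = Δ^{(k)}(T_ε,0) − Δ^{(k)}(T_ε,0) = 0`, so (2.29) is moot for `Ω = Ω₀ = T_ε`.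
[cite: Balaban1982Higgs1, (2.28)–(2.29) p.611] -/
theorem deltaΔk_torus_eq_zero (a msq : ℝ) (k : ℕ) (y y' : Site P k) :
    ((tower P a msq).step k).Δk y y' - ((tower P a msq).step k).Δk y y' = 0 := sub_self _

end B1Prop22ZeroFieldTorus

end

end Literature.MathematicalPhysics.QuantumFieldTheory.Balaban1983to89
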